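import HarnessLib
import Summits.RiemannHypothesis.RiemannHypothesis.Theorems.SignConeExactConeRigidity
import Summits.RiemannHypothesis.RiemannHypothesis.Theorems.SignConeSignConeOscillatoryStatus

/-!
# Route SignCone: the three forms of the prime-free sign-cone inequality are RH-equivalent, by name

HELPER file (`--supports stmt-RiemannHypothesis-16301`; closes nothing). With the support
`ExactConeRigidity` closed (`Theorems.exactConeRigidity_proof`, stmt-RiemannHypothesis-16306) the
conditional equivalence `signConeExact_iff_riemannHypothesis_of` of
`SignConeSignConeOscillatoryStatus.lean` is discharged: the EXACT (slack-free) sign-cone inequality at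
every cutoff — `0 ≤ Re W_ar(F)` for every node-nonnegative `F ∈ P(a)`, all `a > 0` — holds iff the
Riemann Hypothesis does, iff the UNIT-SLACK inequality `X = SignConeInequality` does
(`signConeInequality_iff_riemannHypothesis`, banked), iff Weil positivity does. In terms of the slack
function `μ(a) = inf {Re W_ar(F) / Re F(0) : F ∈ P(a) node-nonnegative}` (non-increasing in `a`):
`RH ⟺ (∀ a, μ(a) ≥ 0) ⟺ (∀ a, μ(a) ≥ -1)`; unconditionally, either `μ ≥ 0` everywhere or `μ(a) < -1`
for all large `a` — the route's magnification gap, recorded by name: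

* `signConeExact_iff_riemannHypothesis`, `signConeExact_iff_signConeInequality`,
  `signConeExact_iff_weilPositivity`.
-/

noncomputable section

-- `Summit.RiemannHypothesis.RiemannHypothesis.…` repeats a namespace component by design (D-0017 layout).
set_option linter.dupNamespace false

open scoped BigOperators ComplexConjugate
open MeasureTheory

namespace Summit.RiemannHypothesis.RiemannHypothesis.Theorems.SignCone

open Summit.RiemannHypothesis.RiemannHypothesis.Theses.SignCone
open Summit.RiemannHypothesis.RiemannHypothesis.Theorems (exactConeRigidity_proof)
open Literature.NumberTheory.LFunctions

/-- **Exact sign-cone inequality ⟺ RH** (unconditional): `→` is the closed support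
`ExactConeRigidity` (`exactConeRigidity_proof`), `←` is Weil positivity under RH
(`signConeExact_of_weilPositivity`, `weil_criterion_holds`). [folklore] -/
theorem signConeExact_iff_riemannHypothesis :
    (∀ a : ℝ, 0 < a → ∀ (k : ℕ) (g : Fin k → ℝ → ℂ),
      (∀ i, (ContDiff ℝ ((⊤ : ℕ∞) : WithTop ℕ∞) (g i) ∧ HasCompactSupport (g i)) ∧
        tsupport (g i) ⊆ Set.Icc (-a) a) →
      let F : ℝ → ℂ := fun t => ∑ i, MeasureTheory.convolution (g i)
        (fun u => (starRingEnd ℂ) ((g i) (-u))) (ContinuousLinearMap.mul ℂ ℂ)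
        MeasureTheory.MeasureSpace.volume t
      (∀ n : ℕ, 2 ≤ n → 0 ≤ (F (Real.log n)).re) →
      let M : ℂ → ℂ := fun s => ∫ u : ℝ, F u * Complex.exp ((s - 1 / 2) * u)
      0 ≤ (M 0 + M 1 + ((1 / (2 * Real.pi) : ℂ) * (∫ t : ℝ, M (1 / 2 + t * Complex.I) *
        ((Complex.digamma (1 / 4 + t / 2 * Complex.I)).re : ℂ)) - F 0 * (Real.log Real.pi : ℂ))).re) ↔
    _root_.Summit.RiemannHypothesis :=
  signConeExact_iff_riemannHypothesis_of exactConeRigidity_proof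

/-- **Exact ⟺ unit slack**: the slack-free sign-cone inequality at every cutoff holds iff the
unit-slack one (`X = SignConeInequality`, the route target) does — both are RH
(`signConeExact_iff_riemannHypothesis`, `signConeInequality_iff_riemannHypothesis`); the cheap
direction `exact → X` is also direct (`signConeInequality_of_exactSignCone`). [folklore] -/
theorem signConeExact_iff_signConeInequality :
    (∀ a : ℝ, 0 < a → ∀ (k : ℕ) (g : Fin k → ℝ → ℂ),
      (∀ i, (ContDiff ℝ ((⊤ : ℕ∞) : WithTop ℕ∞) (g i) ∧ HasCompactSupport (g i)) ∧
        tsupport (g i) ⊆ Set.Icc (-a) a) →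
      let F : ℝ → ℂ := fun t => ∑ i, MeasureTheory.convolution (g i)
        (fun u => (starRingEnd ℂ) ((g i) (-u))) (ContinuousLinearMap.mul ℂ ℂ)
        MeasureTheory.MeasureSpace.volume t
      (∀ n : ℕ, 2 ≤ n → 0 ≤ (F (Real.log n)).re) →
      let M : ℂ → ℂ := fun s => ∫ u : ℝ, F u * Complex.exp ((s - 1 / 2) * u)
      0 ≤ (M 0 + M 1 + ((1 / (2 * Real.pi) : ℂ) * (∫ t : ℝ, M (1 / 2 + t * Complex.I) *
        ((Complex.digamma (1 / 4 + t / 2 * Complex.I)).re : ℂ)) - F 0 * (Real.log Real.pi : ℂ))).re) ↔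
    SignConeInequality :=
  signConeExact_iff_riemannHypothesis.trans signConeInequality_iff_riemannHypothesis.symm

/-- **Exact ⟺ Weil positivity** (through `weil_criterion_holds : RiemannHypothesis ↔ WeilPositivity`). [folklore] -/
theorem signConeExact_iff_weilPositivity :
    (∀ a : ℝ, 0 < a → ∀ (k : ℕ) (g : Fin k → ℝ → ℂ),
      (∀ i, (ContDiff ℝ ((⊤ : ℕ∞) : WithTop ℕ∞) (g i) ∧ HasCompactSupport (g i)) ∧
        tsupport (g i) ⊆ Set.Icc (-a) a) →
      let F : ℝ → ℂ := fun t => ∑ i, MeasureTheory.convolution (g i)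
        (fun u => (starRingEnd ℂ) ((g i) (-u))) (ContinuousLinearMap.mul ℂ ℂ)
        MeasureTheory.MeasureSpace.volume t
      (∀ n : ℕ, 2 ≤ n → 0 ≤ (F (Real.log n)).re) →
      let M : ℂ → ℂ := fun s => ∫ u : ℝ, F u * Complex.exp ((s - 1 / 2) * u)
      0 ≤ (M 0 + M 1 + ((1 / (2 * Real.pi) : ℂ) * (∫ t : ℝ, M (1 / 2 + t * Complex.I) *
        ((Complex.digamma (1 / 4 + t / 2 * Complex.I)).re : ℂ)) - F 0 * (Real.log Real.pi : ℂ))).re) ↔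
    WeilPositivity :=
  signConeExact_iff_riemannHypothesis.trans
    (show _root_.RiemannHypothesis ↔ WeilPositivity from weil_criterion_holds)

end Summit.RiemannHypothesis.RiemannHypothesis.Theorems.SignCone

end
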